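import Summits.ValiantsHypothesis.ValiantsHypothesis.Theorems.KPlusLogSqLawTropicalBandRigidity

/-!
# Route «KPlusLogSqLaw», crux `WeakLifting` (stmt-ValiantsHypothesis-19561), docket D2 — GRADED ROWS: inside one ROW of a strongly-lex design the
# SECOND class is an integer row + column potential on the row's union support

HONEST FRAMING.  Helper file (cell `pub-symmetroid`, seat val-sym-lift-p3 g25, 2026-08-29) `--supports` the crux
`Summit.ValiantsHypothesis.ValiantsHypothesis.Theses.KPlusLogSqLaw.WeakLifting` (ledger item `stmt-ValiantsHypothesis-19561`, route
`KPlusLogSqLaw`; lineage docket D2 = the `K = 4` tropical exponent fork).  With `GradedPages.exists_grading` (pages) this is requirement R3 of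
HOME/val-sym-lift-p3/g4/K4-PAGE-RIGIDITY-AND-CARRIES.md §3–4 in full; it is the two-class application of the band law
`BandRigidity.level_eq_of_recombination_band` (companion file).  STRUCTURE laws for dominant terms of an ARBITRARY design; nothing here bounds a
tropical row, decides the fork, or asserts anything about `WeakLifting`, `TropicalB`, `Lifting`, `KPlusLogSqLaw`, `MatrixDescartes`
(stmt-ValiantsHypothesis-18050) or VP ≠ VNP.

SETTING.  Classes `l₃ ≠ l₂`; `d l ≤ D₃` for `l ≠ l₃` and `(k/2)·m·D₃ ≤ d l₃` (lex regime of `l₃`, as in p494347); `d l ≤ D₂` for `l ∉ {l₂, l₃}` and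
`(k/2)·m·D₂ ≤ d l₂` (lex regime of `l₂` below `l₃`); terms `t₀..t_{k−1}` (`k ≥ 1`) dominant at strictly increasing slopes with equal `l₃`-count
`c₃` — and, for the last two theorems, equal `l₂`-count `c₂` (the terms of one ROW of a strongly-lex `(m,4)` design: `l₃ = 3`, `l₂ = 2`).
* `row_band` — every term recombined columnwise from the `t`'s has its rest at scale `d l₂` (for the `l₂`-indicator) in the band
  `[d l₃·c₃, d l₃·c₃ + m·D₂]` (page rigidity `classCount_eq_of_recombination` pins its `l₃`-count to `c₃`).
* `classCount_two_eq_of_recombination` — ROW RIGIDITY: every term choosing in each column an entry of the row's terms with bijective rows has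
  `l₂`-count `c₂`.
* `exists_rowGrading` — **GRADED ROWS**: `∃ α β : Fin m → ℤ, ∀ r i, [ (t r).2 i = l₂ ] = α ((t r).1 i) + β i`.
[folklore: LP duality / majorization; the packaging is the cell's]
-/

set_option linter.dupNamespace false
set_option autoImplicit false

namespace Summit.ValiantsHypothesis.ValiantsHypothesis.Theorems.KPlusLogSqLaw

open Summit.ValiantsHypothesis.ValiantsHypothesis.Theorems.MatrixDescartes.Negative
open Summit.ValiantsHypothesis.ValiantsHypothesis.Theorems.LacunarySymmetroidMatrixDescartes.TropicalCensus
open scoped BigOperators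
open Finset

namespace BandRigidity

variable {m K : ℕ}

/-- **The row band.**  Classes `l₃ ≠ l₂`, `d l ≤ D₃ (l ≠ l₃)`, `(k/2)·m·D₃ ≤ d l₃`, `d l ≤ D₂ (l ∉ {l₂, l₃})`; page terms with equal
`l₃`-count `c₃`.  Then every term recombined columnwise from the `t`'s has its rest at scale `d l₂` (for the `l₂`-indicator level) in the band
`[d l₃·c₃, d l₃·c₃ + m·D₂]` — page rigidity (p494347) pins its `l₃`-count to `c₃`. -/
theorem row_band {k : ℕ} (d : Fin K → ℕ) (v ε : Fin m → Fin m → Fin K → ℤ)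
    (θ : Fin k → ℤ) (hθ : StrictMono θ) (t : Fin k → Equiv.Perm (Fin m) × (Fin m → Fin K))
    (hdom : ∀ r, IsDominant d v ε (θ r) (t r))
    (l₃ l₂ : Fin K) (h23 : l₂ ≠ l₃)
    (D₃ : ℕ) (hD3 : ∀ l, l ≠ l₃ → d l ≤ D₃) (hlex3 : (k / 2) * m * D₃ ≤ d l₃)
    (D₂ : ℕ) (hD2 : ∀ l, l ≠ l₃ → l ≠ l₂ → d l ≤ D₂)
    (c₃ : ℕ) (hc3 : ∀ r, (univ.filter fun i => (t r).2 i = l₃).card = c₃) (hk : 0 < k)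
    (p : Equiv.Perm (Fin m) × (Fin m → Fin K)) (hp : ∀ i, ∃ r, ((t r).1 i, (t r).2 i) = (p.1 i, p.2 i)) :
    (d l₃ : ℤ) * c₃ ≤ slope d p - (d l₂ : ℤ) * ∑ i, (if p.2 i = l₂ then (1 : ℤ) else 0) ∧
      slope d p - (d l₂ : ℤ) * ∑ i, (if p.2 i = l₂ then (1 : ℤ) else 0) ≤ (d l₃ : ℤ) * c₃ + (m : ℤ) * D₂ := by
  classical
  choose sel hsel using hp
  have hsel1 : ∀ i, (t (sel i)).1 i = p.1 i := fun i => (Prod.mk.inj (hsel i)).1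
  have hsel2 : ∀ i, (t (sel i)).2 i = p.2 i := fun i => (Prod.mk.inj (hsel i)).2
  have hbij : Function.Bijective fun i => (t (sel i)).1 i := by
    have : (fun i => (t (sel i)).1 i) = p.1 := funext hsel1
    rw [this]; exact p.1.bijective
  -- page rigidity: the `l₃`-count of `p` is `c₃`
  have hc3p : (univ.filter fun i => p.2 i = l₃).card = c₃ := by
    have h := classCount_eq_of_recombination d v ε θ hθ t hdom l₃ D₃ hD3 hlex3 c₃ hc3 hk sel hbij
    rw [← h]
    congr 1
    ext i; simp [hsel2 i]
  -- slope = d l₂ · #l₂ + (rest over the non-l₂ columns)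
  have hsl := pageRigid_slope_eq_count_add_rest d l₂ p
  set T := ∑ i ∈ univ.filter (fun i => ¬ p.2 i = l₂), (d (p.2 i) : ℤ) with hT
  have hrest : slope d p - (d l₂ : ℤ) * ∑ i, (if p.2 i = l₂ then (1 : ℤ) else 0) = T := by
    rw [← pageRigid_count_eq_sum_ite, hsl]; ring
  -- split the rest by the `l₃`-columns
  have hsplit := (sum_filter_add_sum_filter_not (univ.filter fun i => ¬ p.2 i = l₂) (fun i => p.2 i = l₃)
    (fun i => (d (p.2 i) : ℤ))).symm
  have hA : (univ.filter fun i => ¬ p.2 i = l₂).filter (fun i => p.2 i = l₃) = univ.filter (fun i => p.2 i = l₃) := by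
    ext i
    simp only [mem_filter, mem_univ, true_and]
    constructor
    · exact fun h => h.2
    · intro h; exact ⟨by rw [h]; exact fun h' => h23 h'.symm, h⟩
  have h3sum : ∑ i ∈ univ.filter (fun i => p.2 i = l₃), (d (p.2 i) : ℤ) = (d l₃ : ℤ) * c₃ := by
    rw [sum_congr rfl (fun i hi => by rw [(mem_filter.mp hi).2] : ∀ i ∈ univ.filter (fun i => p.2 i = l₃),
      (d (p.2 i) : ℤ) = (d l₃ : ℤ)), sum_const, hc3p, nsmul_eq_mul, mul_comm]
  set S := ∑ i ∈ (univ.filter fun i => ¬ p.2 i = l₂).filter (fun i => ¬ p.2 i = l₃), (d (p.2 i) : ℤ) with hS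
  have hTS : T = (d l₃ : ℤ) * c₃ + S := by rw [hT, hsplit, hA, h3sum]
  have hS0 : 0 ≤ S := sum_nonneg fun i _ => by positivity
  have hS1 : S ≤ (m : ℤ) * D₂ := by
    calc S ≤ ∑ _i ∈ (univ.filter fun i => ¬ p.2 i = l₂).filter (fun i => ¬ p.2 i = l₃), (D₂ : ℤ) := by
          refine sum_le_sum fun i hi => ?_
          have hi' := mem_filter.mp hi
          exact_mod_cast hD2 _ hi'.2 (mem_filter.mp hi'.1).2
      _ = (((univ.filter fun i => ¬ p.2 i = l₂).filter (fun i => ¬ p.2 i = l₃)).card : ℤ) * D₂ := by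
          rw [sum_const, nsmul_eq_mul]
      _ ≤ (m : ℤ) * D₂ := by
          refine mul_le_mul_of_nonneg_right ?_ (by positivity)
          exact_mod_cast (card_filter_le _ _).trans ((card_filter_le _ _).trans (by simp))
  rw [hrest, hTS]
  constructor <;> linarith

/-- **ROW RIGIDITY, perfect-matching form.**  In the regime of `row_band` and with the `t`'s also of equal `l₂`-count `c₂` (one ROW of a
strongly-lex design), every term choosing in each column an entry of the `t`'s with bijective rows has `l₂`-count `c₂`. -/
theorem classCount_two_eq_of_recombination {k : ℕ} (d : Fin K → ℕ) (v ε : Fin m → Fin m → Fin K → ℤ)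
    (θ : Fin k → ℤ) (hθ : StrictMono θ) (t : Fin k → Equiv.Perm (Fin m) × (Fin m → Fin K))
    (hdom : ∀ r, IsDominant d v ε (θ r) (t r))
    (l₃ l₂ : Fin K) (h23 : l₂ ≠ l₃)
    (D₃ : ℕ) (hD3 : ∀ l, l ≠ l₃ → d l ≤ D₃) (hlex3 : (k / 2) * m * D₃ ≤ d l₃)
    (D₂ : ℕ) (hD2 : ∀ l, l ≠ l₃ → l ≠ l₂ → d l ≤ D₂) (hlex2 : (k / 2) * m * D₂ ≤ d l₂)
    (c₃ : ℕ) (hc3 : ∀ r, (univ.filter fun i => (t r).2 i = l₃).card = c₃)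
    (c₂ : ℕ) (hc2 : ∀ r, (univ.filter fun i => (t r).2 i = l₂).card = c₂) (hk : 0 < k)
    (sel : Fin m → Fin k) (hbij : Function.Bijective fun i => (t (sel i)).1 i) :
    (univ.filter fun i => (t (sel i)).2 i = l₂).card = c₂ := by
  classical
  have hc : ∀ r, ∑ i, (fun l => if l = l₂ then (1 : ℤ) else 0) ((t r).2 i) = (c₂ : ℤ) := by
    intro r; simp only []; rw [← pageRigid_count_eq_sum_ite, hc2]
  have hE : 0 ≤ (d l₂ : ℤ) := by positivity
  have hlex : (((k / 2 : ℕ)) : ℤ) * ((m : ℤ) * D₂) ≤ (d l₂ : ℤ) := by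
    have : (((k / 2) * m * D₂ : ℕ) : ℤ) ≤ (d l₂ : ℤ) := by exact_mod_cast hlex2
    simpa [mul_assoc] using this
  have hband : ∀ p : Equiv.Perm (Fin m) × (Fin m → Fin K),
      (∀ i, ∃ r, ((t r).1 i, (t r).2 i) = (p.1 i, p.2 i)) →
      (d l₃ : ℤ) * c₃ ≤ slope d p - (d l₂ : ℤ) * ∑ i, (fun l => if l = l₂ then (1 : ℤ) else 0) (p.2 i) ∧
        slope d p - (d l₂ : ℤ) * ∑ i, (fun l => if l = l₂ then (1 : ℤ) else 0) (p.2 i) ≤ (d l₃ : ℤ) * c₃ + (m : ℤ) * D₂ :=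
    fun p hp => row_band d v ε θ hθ t hdom l₃ l₂ h23 D₃ hD3 hlex3 D₂ hD2 c₃ hc3 hk p hp
  have h := level_eq_of_recombination_band d v ε θ hθ t hdom (fun l => if l = l₂ then (1 : ℤ) else 0) (d l₂ : ℤ)
    ((d l₃ : ℤ) * c₃) ((m : ℤ) * D₂) hE hlex hband (c₂ : ℤ) hc hk sel hbij
  have h' : (((univ.filter fun i => (t (sel i)).2 i = l₂).card : ℕ) : ℤ) = (c₂ : ℤ) := by
    rw [← h, pageRigid_count_eq_sum_ite (m := m) l₂ ((Equiv.ofBijective _ hbij), fun i => (t (sel i)).2 i)]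
  exact_mod_cast h'

/-- **GRADED ROWS.**  Classes `l₃ ≠ l₂`; the exponent of `l₃` dominates all others by the factor `(k/2)·m` and the exponent of `l₂` dominates
all others but `l₃` by the same factor; `t₀..t_{k−1}` (`k ≥ 1`) dominant at strictly increasing slopes with equal `l₃`-count `c₃` and equal
`l₂`-count `c₂` (the terms of one ROW of a strongly-lex design).  Then the `l₂`-indicator on the union support is an integer row + column
potential. -/
theorem exists_rowGrading {k : ℕ} (d : Fin K → ℕ) (v ε : Fin m → Fin m → Fin K → ℤ)
    (θ : Fin k → ℤ) (hθ : StrictMono θ) (t : Fin k → Equiv.Perm (Fin m) × (Fin m → Fin K))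
    (hdom : ∀ r, IsDominant d v ε (θ r) (t r))
    (l₃ l₂ : Fin K) (h23 : l₂ ≠ l₃)
    (D₃ : ℕ) (hD3 : ∀ l, l ≠ l₃ → d l ≤ D₃) (hlex3 : (k / 2) * m * D₃ ≤ d l₃)
    (D₂ : ℕ) (hD2 : ∀ l, l ≠ l₃ → l ≠ l₂ → d l ≤ D₂) (hlex2 : (k / 2) * m * D₂ ≤ d l₂)
    (c₃ : ℕ) (hc3 : ∀ r, (univ.filter fun i => (t r).2 i = l₃).card = c₃)
    (c₂ : ℕ) (hc2 : ∀ r, (univ.filter fun i => (t r).2 i = l₂).card = c₂) (hk : 0 < k) :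
    ∃ α β : Fin m → ℤ, ∀ (r : Fin k) (i : Fin m),
      (if (t r).2 i = l₂ then (1 : ℤ) else 0) = α ((t r).1 i) + β i := by
  classical
  let φ : Fin K → ℤ := fun l => if l = l₂ then 1 else 0
  have hc : ∀ r, ∑ i, φ ((t r).2 i) = (c₂ : ℤ) := by
    intro r; simp only [φ]; rw [← pageRigid_count_eq_sum_ite, hc2]
  have hE : 0 ≤ (d l₂ : ℤ) := by positivity
  have hlex : (((k / 2 : ℕ)) : ℤ) * ((m : ℤ) * D₂) ≤ (d l₂ : ℤ) := by
    have : (((k / 2) * m * D₂ : ℕ) : ℤ) ≤ (d l₂ : ℤ) := by exact_mod_cast hlex2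
    simpa [mul_assoc] using this
  have hband : ∀ p : Equiv.Perm (Fin m) × (Fin m → Fin K),
      (∀ i, ∃ r, ((t r).1 i, (t r).2 i) = (p.1 i, p.2 i)) →
      (d l₃ : ℤ) * c₃ ≤ slope d p - (d l₂ : ℤ) * ∑ i, φ (p.2 i) ∧
        slope d p - (d l₂ : ℤ) * ∑ i, φ (p.2 i) ≤ (d l₃ : ℤ) * c₃ + (m : ℤ) * D₂ :=
    fun p hp => row_band d v ε θ hθ t hdom l₃ l₂ h23 D₃ hD3 hlex3 D₂ hD2 c₃ hc3 hk p hp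
  obtain ⟨α, β, h⟩ := exists_levelGrading d v ε θ hθ t hdom φ (d l₂ : ℤ) ((d l₃ : ℤ) * c₃) ((m : ℤ) * D₂) hE hlex hband
    (c₂ : ℤ) hc hk
  exact ⟨α, β, fun r i => by simpa [φ] using h r i⟩

end BandRigidity

end Summit.ValiantsHypothesis.ValiantsHypothesis.Theorems.KPlusLogSqLaw
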